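import Summits.MatrixMultiplication.MatrixMultiplication.Theorems.AbelianSTPPCensusTB3StatDefs

/-!
# T_B static certificate, range `5216 … 5590` (t*-indexed linear checker with the k-member tree at `τ = 2375/1000`): kernel evaluation, the shape checks of the tree-heavy volumes `3179`, `3192`, `3211` on the order sub-range(s) `5405 … 5467` (one theorem per (volume, sub-range): bounded kernel memory)

Cell mm-stpp (rung F-M1), tier T_B = «beat `2.375` (Coppersmith–Winograd)»; checker in `AbelianSTPPCensusTB3StatDefs.lean`, table and bucket lists in `AbelianSTPPCensusTB3StatData.lean`
(pattern: theory g12's `AbelianSTPPCensusTAStatDDom*/DCk*.lean`).  `decide` with kernel reduction (standard axioms; no `native_decide`), `Elab.async false`;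
consumed by `TB3Stat.checkV_sound` / `TB3Stat.domV_sound` / `TB3Stat.m2V_sound` in the leaf `AbelianSTPPCensusLeafTB5590Closed.lean`.
WHAT THIS IS NOT: arithmetic on shape lists only; no statement about STPP families or `ω`.
-/

set_option linter.dupNamespace false
set_option autoImplicit false
set_option Elab.async false

namespace Summit.MatrixMultiplication.MatrixMultiplication.Theorems.TB3Stat

set_option maxHeartbeats 0 in
/-- Heavy volume `3179` (3 shapes; 61183 tree nodes over all orders), orders `5405 … 5467`: every sorted candidate shape passes `checkShape 5405 5467`. [original] -/
theorem ck3179r3 : TB3Stat.checkV 5405 5467 1 3179 = true := by decide +kernel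

set_option maxHeartbeats 0 in
/-- Heavy volume `3192` (45 shapes; 64452 tree nodes over all orders), orders `5405 … 5467`: every sorted candidate shape passes `checkShape 5405 5467`. [original] -/
theorem ck3192r3 : TB3Stat.checkV 5405 5467 1 3192 = true := by decide +kernel

set_option maxHeartbeats 0 in
/-- Heavy volume `3211` (3 shapes; 58549 tree nodes over all orders), orders `5405 … 5467`: every sorted candidate shape passes `checkShape 5405 5467`. [original] -/
theorem ck3211r3 : TB3Stat.checkV 5405 5467 1 3211 = true := by decide +kernel

end Summit.MatrixMultiplication.MatrixMultiplication.Theorems.TB3Stat
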